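import Mathlib
import Summits.NavierStokesRegularity.NavierStokesRegularity.Theorems.EulerZoomLiouvillePowerGaugeEulerLiouvilleHoopCapHardy
import Summits.NavierStokesRegularity.NavierStokesRegularity.Theorems.EulerZoomLiouvillePowerGaugeEulerLiouvilleCondenserLogMeanSquare
import HarnessLib

/-!
# Hoop core — t54-CC (tools): Cauchy–Schwarz on `[0,T] × circle`, wall-circle bounds, chart forms of the cap functionals

Sub-problem `NavierStokesRegularity`, crux `PowerGaugeEulerLiouville` (a crux CLASS of self-similar Euler/NS strata on the MODEL lattice —
not NS regularity, not E).  Seat ns-ezl-w3 g7, tag t54-CC (nsreg-p2 g41 ROUND-51 «THE CAPS COME FOR FREE» §2 `CapCostBound`,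
`r51/Sketch51.lean` 3a26356e4f98d965).  Class-free, `C¹`.  The tools behind `…HoopCapCost` (`HoopCore.capCostBound`):

* §1 `sq_integral_integral_mul_le` — Cauchy–Schwarz on the box `[0,T] × [0,2π]` for continuous integrands
  (`(∫∫ fg)² ≤ (∫∫ f²)(∫∫ g²)`, twice `Condenser.sq_integral_mul_le_of_intervalIntegrable`), monotonicity of the iterated integral
  (radius outside) — the square-root bookkeeping `X² ≤ M²PQ ⇒ |X| ≤ M√P√Q` is `Elgindi.abs_le_mul_sqrt_mul_sqrt`;
* §2 wall-circle bounds: `‖V‖ ≤ w` on the circle `t = T₀` gives `⟨V_r² + V_z²⟩_θ, ⟨V_r²⟩_θ ≤ w²`, `⟨(k + V_z)²⟩_θ ≤ (|k| + w)²`, and with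
  the cap Hardy bounds (`…HoopCapHardy`) `∫₀^{T₀}⟨V_r²⟩_θ ≤ T₀(2w² + D/π)`, `∫₀^{T₀}⟨(k+V_z)²⟩_θ ≤ T₀(2(|k|+w)² + D/π)`, `D = discEnergy V σ T₀`;
* §3 chart forms: `∫₀ᵀ∫₀^{2π}(k + V_z(axisPt σ t θ))² = 2π∫₀ᵀ⟨(k+V_z)²⟩_θ`, the same for `V_r` via the smooth ray component
  `⟪V(axisPt σ t θ), R_θe₀⟫` (`t > 0` a.e.), `discMass V σ T = (2π)⁻¹∫₀ᵀ∫₀^{2π} t·V_z(axisPt σ t θ)`, and `|c₀cos θ + c₁sin θ| ≤ cylRadius c`.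

WHAT THIS IS NOT: not NS, not E — class-free calculus on discs; 19832 OPEN; NS regularity NOT proved.  [nsreg-p2 g41 ROUND-51 §2; folklore]
-/

noncomputable section

open MeasureTheory Set Metric Real Function WithLp intervalIntegral
open scoped InnerProductSpace RealInnerProductSpace Interval

set_option linter.dupNamespace false

namespace Summit.NavierStokesRegularity.NavierStokesRegularity.Theorems.PowerGaugeEulerLiouville.HoopCore

open Literature.Analysis Literature.Analysis.FluidPDE

variable {V : EuclideanSpace ℝ (Fin 3) → EuclideanSpace ℝ (Fin 3)}

/-! ## §1 Cauchy–Schwarz on the box and square-root bookkeeping -/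

/-- `uncurry f`, `uncurry g` continuous ⇒ `uncurry (fun t θ ↦ f t θ * g t θ)` continuous. [folklore] -/
theorem continuous_uncurry_mul {f g : ℝ → ℝ → ℝ} (hf : Continuous (uncurry f)) (hg : Continuous (uncurry g)) :
    Continuous (uncurry fun t θ : ℝ => f t θ * g t θ) :=
  hf.mul hg

/-- A continuous function of the angle alone is jointly continuous in `(t, θ)`. [folklore] -/
theorem continuous_uncurry_of_right {m : ℝ → ℝ} (hm : Continuous m) : Continuous (uncurry fun _ θ : ℝ => m θ) :=
  hm.comp continuous_snd

/-- A continuous function of the radius alone is jointly continuous in `(t, θ)`. [folklore] -/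
theorem continuous_uncurry_of_left {m : ℝ → ℝ} (hm : Continuous m) : Continuous (uncurry fun t _ : ℝ => m t) :=
  hm.comp continuous_fst

/-- **Monotonicity of the iterated integral over `[0, T] × [0, 2π]`** (radius outside) for continuous integrands compared on
`[0,T] × ℝ`. [folklore] -/
theorem integral_integral_mono_continuous' {H Φ : ℝ → ℝ → ℝ} (hH : Continuous (uncurry H)) (hΦ : Continuous (uncurry Φ))
    {T : ℝ} (hT : 0 ≤ T) (hle : ∀ t ∈ Icc 0 T, ∀ θ, H t θ ≤ Φ t θ) :
    ∫ t in (0 : ℝ)..T, ∫ θ in (0 : ℝ)..2 * π, H t θ ≤ ∫ t in (0 : ℝ)..T, ∫ θ in (0 : ℝ)..2 * π, Φ t θ := by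
  refine intervalIntegral.integral_mono_on hT
    ((intervalIntegral.continuous_parametric_intervalIntegral_of_continuous' hH _ _).intervalIntegrable _ _)
    ((intervalIntegral.continuous_parametric_intervalIntegral_of_continuous' hΦ _ _).intervalIntegrable _ _) fun t ht => ?_
  exact intervalIntegral.integral_mono_on (by positivity) ((continuous_of_uncurry_left hH t).intervalIntegrable _ _)
    ((continuous_of_uncurry_left hΦ t).intervalIntegrable _ _) fun θ _ => hle t ht θ

/-- **Cauchy–Schwarz on the box `[0,T] × [0,2π]`** for continuous integrands: `(∫₀ᵀ∫₀^{2π} f g)² ≤ (∫₀ᵀ∫₀^{2π} f²)(∫₀ᵀ∫₀^{2π} g²)`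
(Cauchy–Schwarz in `θ` at fixed `t`, then in `t` for `√(∫θ f²)`, `√(∫θ g²)`). [folklore] -/
theorem sq_integral_integral_mul_le {f g : ℝ → ℝ → ℝ} (hf : Continuous (uncurry f)) (hg : Continuous (uncurry g))
    {T : ℝ} (hT : 0 ≤ T) :
    (∫ t in (0 : ℝ)..T, ∫ θ in (0 : ℝ)..2 * π, f t θ * g t θ) ^ 2
      ≤ (∫ t in (0 : ℝ)..T, ∫ θ in (0 : ℝ)..2 * π, f t θ ^ 2) * (∫ t in (0 : ℝ)..T, ∫ θ in (0 : ℝ)..2 * π, g t θ ^ 2) := by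
  have h2π : (0 : ℝ) ≤ 2 * π := by positivity
  obtain ⟨A, hA⟩ : ∃ A : ℝ → ℝ, A = fun t => ∫ θ in (0 : ℝ)..2 * π, f t θ ^ 2 := ⟨_, rfl⟩
  obtain ⟨B, hB⟩ : ∃ B : ℝ → ℝ, B = fun t => ∫ θ in (0 : ℝ)..2 * π, g t θ ^ 2 := ⟨_, rfl⟩
  obtain ⟨F, hF⟩ : ∃ F : ℝ → ℝ, F = fun t => ∫ θ in (0 : ℝ)..2 * π, f t θ * g t θ := ⟨_, rfl⟩
  have hAc : Continuous A := by
    rw [hA]; exact intervalIntegral.continuous_parametric_intervalIntegral_of_continuous' (continuous_uncurry_sq hf) _ _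
  have hBc : Continuous B := by
    rw [hB]; exact intervalIntegral.continuous_parametric_intervalIntegral_of_continuous' (continuous_uncurry_sq hg) _ _
  have hFc : Continuous F := by
    rw [hF]; exact intervalIntegral.continuous_parametric_intervalIntegral_of_continuous' (continuous_uncurry_mul hf hg) _ _
  have hAt : ∀ t, A t = ∫ θ in (0 : ℝ)..2 * π, f t θ ^ 2 := fun t => by rw [hA]
  have hBt : ∀ t, B t = ∫ θ in (0 : ℝ)..2 * π, g t θ ^ 2 := fun t => by rw [hB]
  have hFt : ∀ t, F t = ∫ θ in (0 : ℝ)..2 * π, f t θ * g t θ := fun t => by rw [hF]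
  have hAnn : ∀ t, 0 ≤ A t := fun t => by rw [hAt]; exact intervalIntegral.integral_nonneg h2π fun θ _ => sq_nonneg _
  have hBnn : ∀ t, 0 ≤ B t := fun t => by rw [hBt]; exact intervalIntegral.integral_nonneg h2π fun θ _ => sq_nonneg _
  -- Cauchy–Schwarz in `θ` at fixed `t`
  have hpt : ∀ t, |F t| ≤ Real.sqrt (A t) * Real.sqrt (B t) := by
    intro t
    have hf1 : Continuous fun θ => f t θ := continuous_of_uncurry_left hf t
    have hg1 : Continuous fun θ => g t θ := continuous_of_uncurry_left hg t
    have hcs := Condenser.sq_integral_mul_le_of_intervalIntegrable h2π ((hf1.fun_pow 2).intervalIntegrable _ _)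
      ((hg1.fun_pow 2).intervalIntegrable _ _) ((hf1.fun_mul hg1).intervalIntegrable _ _)
    rw [hFt, hAt, hBt, ← Real.sqrt_mul (intervalIntegral.integral_nonneg h2π fun θ _ => sq_nonneg _)]
    exact Real.abs_le_sqrt hcs
  -- integrate in `t` and Cauchy–Schwarz again
  have hI1 : |∫ t in (0 : ℝ)..T, F t| ≤ ∫ t in (0 : ℝ)..T, |F t| := intervalIntegral.abs_integral_le_integral_abs hT
  have hI2 : ∫ t in (0 : ℝ)..T, |F t| ≤ ∫ t in (0 : ℝ)..T, Real.sqrt (A t) * Real.sqrt (B t) :=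
    intervalIntegral.integral_mono_on hT (hFc.intervalIntegrable _ _).abs
      ((hAc.sqrt.fun_mul hBc.sqrt).intervalIntegrable _ _) fun t _ => hpt t
  have hI3 : (∫ t in (0 : ℝ)..T, Real.sqrt (A t) * Real.sqrt (B t)) ^ 2
      ≤ (∫ t in (0 : ℝ)..T, A t) * (∫ t in (0 : ℝ)..T, B t) := by
    have h := Condenser.sq_integral_mul_le_of_intervalIntegrable hT ((hAc.sqrt.fun_pow 2).intervalIntegrable _ _)
      ((hBc.sqrt.fun_pow 2).intervalIntegrable _ _) ((hAc.sqrt.fun_mul hBc.sqrt).intervalIntegrable _ _)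
    have e1 : ∫ t in (0 : ℝ)..T, Real.sqrt (A t) ^ 2 = ∫ t in (0 : ℝ)..T, A t :=
      intervalIntegral.integral_congr fun t _ => Real.sq_sqrt (hAnn t)
    have e2 : ∫ t in (0 : ℝ)..T, Real.sqrt (B t) ^ 2 = ∫ t in (0 : ℝ)..T, B t :=
      intervalIntegral.integral_congr fun t _ => Real.sq_sqrt (hBnn t)
    rw [e1, e2] at h
    exact h
  have eF : ∫ t in (0 : ℝ)..T, ∫ θ in (0 : ℝ)..2 * π, f t θ * g t θ = ∫ t in (0 : ℝ)..T, F t := by rw [hF]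
  have eA : ∫ t in (0 : ℝ)..T, ∫ θ in (0 : ℝ)..2 * π, f t θ ^ 2 = ∫ t in (0 : ℝ)..T, A t := by rw [hA]
  have eB : ∫ t in (0 : ℝ)..T, ∫ θ in (0 : ℝ)..2 * π, g t θ ^ 2 = ∫ t in (0 : ℝ)..T, B t := by rw [hB]
  rw [eF, eA, eB]
  have h0 : 0 ≤ ∫ t in (0 : ℝ)..T, |F t| := intervalIntegral.integral_nonneg hT fun t _ => abs_nonneg _
  calc (∫ t in (0 : ℝ)..T, F t) ^ 2 = |∫ t in (0 : ℝ)..T, F t| ^ 2 := (sq_abs _).symm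
    _ ≤ (∫ t in (0 : ℝ)..T, |F t|) ^ 2 := pow_le_pow_left₀ (abs_nonneg _) hI1 2
    _ ≤ (∫ t in (0 : ℝ)..T, Real.sqrt (A t) * Real.sqrt (B t)) ^ 2 := pow_le_pow_left₀ h0 hI2 2
    _ ≤ (∫ t in (0 : ℝ)..T, A t) * (∫ t in (0 : ℝ)..T, B t) := hI3

/-- `|c₀ cos θ + c₁ sin θ| ≤ cylRadius c` (Cauchy–Schwarz in the plane). [folklore] -/
theorem abs_cos_sin_comb_le_cylRadius (c : EuclideanSpace ℝ (Fin 3)) (θ : ℝ) :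
    |c 0 * Real.cos θ + c 1 * Real.sin θ| ≤ cylRadius c := by
  unfold cylRadius
  refine Real.abs_le_sqrt ?_
  nlinarith [sq_nonneg (c 0 * Real.sin θ - c 1 * Real.cos θ), Real.sin_sq_add_cos_sq θ]

/-! ## §2 Wall-circle bounds -/

/-- On the wall circle `‖V‖ ≤ w` ⇒ `⟨V_r² + V_z²⟩_θ(σ,T₀) ≤ w²` (`T₀ > 0`). [folklore] -/
theorem circleAvg_rz_sq_le_of_wall (σ : ℝ) {T₀ w : ℝ} (hT₀ : 0 < T₀) (hwall : ∀ θ : ℝ, ‖V (axisPt σ T₀ θ)‖ ≤ w) :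
    circleAvg (fun y => radialVelocity V y ^ 2 + axialVelocity V y ^ 2) σ T₀ ≤ w ^ 2 := by
  refine (abs_le.1 (abs_circleAvg_le (M := w ^ 2) fun θ => ?_)).2
  rw [abs_of_nonneg (by positivity)]
  exact (radialVelocity_sq_add_axialVelocity_sq_le_norm_sq V σ hT₀ θ).trans (pow_le_pow_left₀ (norm_nonneg _) (hwall θ) 2)

/-- On the wall circle `‖V‖ ≤ w` ⇒ `⟨V_r²⟩_θ(σ,T₀) ≤ w²`. [folklore] -/
theorem circleAvg_r_sq_le_of_wall (σ : ℝ) {T₀ w : ℝ} (hwall : ∀ θ : ℝ, ‖V (axisPt σ T₀ θ)‖ ≤ w) :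
    circleAvg (fun y => radialVelocity V y ^ 2) σ T₀ ≤ w ^ 2 := by
  refine (abs_le.1 (abs_circleAvg_le (M := w ^ 2) fun θ => ?_)).2
  rw [abs_of_nonneg (by positivity), ← sq_abs]
  exact pow_le_pow_left₀ (abs_nonneg _) ((abs_radialVelocity_le V _).trans (hwall θ)) 2

/-- On the wall circle `‖V‖ ≤ w` ⇒ `⟨(k + V_z)²⟩_θ(σ,T₀) ≤ (|k| + w)²`. [folklore] -/
theorem circleAvg_shift_z_sq_le_of_wall (σ k : ℝ) {T₀ w : ℝ} (hwall : ∀ θ : ℝ, ‖V (axisPt σ T₀ θ)‖ ≤ w) :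
    circleAvg (fun y => (k + axialVelocity V y) ^ 2) σ T₀ ≤ (|k| + w) ^ 2 := by
  refine (abs_le.1 (abs_circleAvg_le (M := (|k| + w) ^ 2) fun θ => ?_)).2
  rw [abs_of_nonneg (by positivity), ← sq_abs]
  refine pow_le_pow_left₀ (abs_nonneg _) ((abs_add_le k _).trans ?_) 2
  linarith [(abs_axialVelocity_le V (axisPt σ T₀ θ)).trans (hwall θ)]

/-- **Integrated radial bound**: `∫₀^{T₀}⟨V_r²⟩_θ(σ,t) dt ≤ T₀·(2w² + discEnergy/π)` (`radialRayHardy` + the wall circle). [nsreg-p2 g41 ROUND-51 §2] -/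
theorem integral_circleAvg_r_sq_le_of_wall (hV : ContDiff ℝ 1 V) (σ : ℝ) {T₀ w : ℝ} (hT₀ : 0 < T₀)
    (hwall : ∀ θ : ℝ, ‖V (axisPt σ T₀ θ)‖ ≤ w) :
    ∫ t in (0 : ℝ)..T₀, circleAvg (fun y => radialVelocity V y ^ 2) σ t
      ≤ T₀ * (2 * w ^ 2 + discEnergy V σ T₀ / Real.pi) := by
  have h := radialRayHardy V σ T₀ hT₀ hV
  have hc := mul_le_mul_of_nonneg_left (circleAvg_r_sq_le_of_wall (V := V) σ hwall) (by positivity : (0 : ℝ) ≤ 2 * T₀)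
  have e : T₀ * (2 * w ^ 2 + discEnergy V σ T₀ / Real.pi) = 2 * T₀ * w ^ 2 + T₀ / Real.pi * discEnergy V σ T₀ := by ring
  rw [e]
  linarith

/-- **Integrated axial bound with shift**: `∫₀^{T₀}⟨(k + V_z)²⟩_θ(σ,t) dt ≤ T₀·(2(|k| + w)² + discEnergy/π)` (`axialRayHardy` + the wall
circle). [nsreg-p2 g41 ROUND-51 §2] -/
theorem integral_circleAvg_shift_z_sq_le_of_wall (hV : ContDiff ℝ 1 V) (σ k : ℝ) {T₀ w : ℝ} (hT₀ : 0 < T₀)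
    (hwall : ∀ θ : ℝ, ‖V (axisPt σ T₀ θ)‖ ≤ w) :
    ∫ t in (0 : ℝ)..T₀, circleAvg (fun y => (k + axialVelocity V y) ^ 2) σ t
      ≤ T₀ * (2 * (|k| + w) ^ 2 + discEnergy V σ T₀ / Real.pi) := by
  have h := axialRayHardy V k σ T₀ hT₀ hV
  have hc := mul_le_mul_of_nonneg_left (circleAvg_shift_z_sq_le_of_wall (V := V) σ k hwall) (by positivity : (0 : ℝ) ≤ 2 * T₀)
  have e : T₀ * (2 * (|k| + w) ^ 2 + discEnergy V σ T₀ / Real.pi)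
      = 2 * T₀ * (|k| + w) ^ 2 + T₀ / Real.pi * discEnergy V σ T₀ := by ring
  rw [e]
  linarith

/-- **Integrated axial bound**: `∫₀^{T₀}⟨V_z²⟩_θ(σ,t) dt ≤ T₀·(2w² + discEnergy/π)`. [nsreg-p2 g41 ROUND-51 §2] -/
theorem integral_circleAvg_z_sq_le_of_wall (hV : ContDiff ℝ 1 V) (σ : ℝ) {T₀ w : ℝ} (hT₀ : 0 < T₀)
    (hwall : ∀ θ : ℝ, ‖V (axisPt σ T₀ θ)‖ ≤ w) :
    ∫ t in (0 : ℝ)..T₀, circleAvg (fun y => axialVelocity V y ^ 2) σ t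
      ≤ T₀ * (2 * w ^ 2 + discEnergy V σ T₀ / Real.pi) := by
  have h := integral_circleAvg_shift_z_sq_le_of_wall hV σ 0 hT₀ hwall
  simpa only [zero_add, abs_zero] using h

/-! ## §3 Chart forms of the cap functionals -/

/-- `∫₀ᵀ∫₀^{2π} (k + V_z(axisPt σ t θ))² dθ dt = 2π·∫₀ᵀ ⟨(k + V_z)²⟩_θ(σ,t) dt`. [folklore] -/
theorem integral_integral_shift_z_sq_eq (V : EuclideanSpace ℝ (Fin 3) → EuclideanSpace ℝ (Fin 3)) (σ k T : ℝ) :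
    ∫ t in (0 : ℝ)..T, ∫ θ in (0 : ℝ)..2 * π, (k + axialVelocity V (axisPt σ t θ)) ^ 2
      = 2 * Real.pi * ∫ t in (0 : ℝ)..T, circleAvg (fun y => (k + axialVelocity V y) ^ 2) σ t := by
  rw [← intervalIntegral.integral_const_mul]
  refine intervalIntegral.integral_congr fun t _ => ?_
  unfold circleAvg
  rw [← mul_assoc, mul_one_div_cancel (by positivity : (2 : ℝ) * Real.pi ≠ 0), one_mul]

/-- `∫₀ᵀ∫₀^{2π} V_z(axisPt σ t θ)² dθ dt = 2π·∫₀ᵀ ⟨V_z²⟩_θ(σ,t) dt`. [folklore] -/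
theorem integral_integral_z_sq_eq (V : EuclideanSpace ℝ (Fin 3) → EuclideanSpace ℝ (Fin 3)) (σ T : ℝ) :
    ∫ t in (0 : ℝ)..T, ∫ θ in (0 : ℝ)..2 * π, axialVelocity V (axisPt σ t θ) ^ 2
      = 2 * Real.pi * ∫ t in (0 : ℝ)..T, circleAvg (fun y => axialVelocity V y ^ 2) σ t := by
  rw [← intervalIntegral.integral_const_mul]
  refine intervalIntegral.integral_congr fun t _ => ?_
  unfold circleAvg
  rw [← mul_assoc, mul_one_div_cancel (by positivity : (2 : ℝ) * Real.pi ≠ 0), one_mul]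

/-- `∫₀^{T₀}∫₀^{2π} ⟪V(axisPt σ t θ), R_θe₀⟫² dθ dt = 2π·∫₀^{T₀} ⟨V_r²⟩_θ(σ,t) dt` (`T₀ ≥ 0`; the integrands agree for `t > 0`). [folklore] -/
theorem integral_integral_a_sq_eq (V : EuclideanSpace ℝ (Fin 3) → EuclideanSpace ℝ (Fin 3)) (σ : ℝ) {T₀ : ℝ} (hT₀ : 0 ≤ T₀) :
    ∫ t in (0 : ℝ)..T₀, ∫ θ in (0 : ℝ)..2 * π, ⟪V (axisPt σ t θ), rotZ θ (EuclideanSpace.single (0 : Fin 3) (1 : ℝ))⟫ ^ 2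
      = 2 * Real.pi * ∫ t in (0 : ℝ)..T₀, circleAvg (fun y => radialVelocity V y ^ 2) σ t := by
  rw [← intervalIntegral.integral_const_mul]
  refine intervalIntegral.integral_congr_ae (ae_of_all _ fun t ht => ?_)
  rw [uIoc_of_le hT₀] at ht
  unfold circleAvg
  rw [← mul_assoc, mul_one_div_cancel (by positivity : (2 : ℝ) * Real.pi ≠ 0), one_mul]
  refine intervalIntegral.integral_congr fun θ _ => ?_
  beta_reduce
  rw [inner_rotZ_single_zero_eq_radialVelocity V σ ht.1 θ]

/-- **The disc mass in the chart**: `discMass V σ T = (2π)⁻¹ ∫₀ᵀ∫₀^{2π} t·V_z(axisPt σ t θ) dθ dt`. [folklore] -/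
theorem discMass_eq_chart (V : EuclideanSpace ℝ (Fin 3) → EuclideanSpace ℝ (Fin 3)) (σ T : ℝ) :
    discMass V σ T = 1 / (2 * Real.pi) * ∫ t in (0 : ℝ)..T, ∫ θ in (0 : ℝ)..2 * π, t * axialVelocity V (axisPt σ t θ) := by
  unfold discMass circleAvg
  rw [← intervalIntegral.integral_const_mul]
  refine intervalIntegral.integral_congr fun t _ => ?_
  rw [intervalIntegral.integral_const_mul]
  ring

/-- `∫₀ᵀ∫₀^{2π} t² dθ dt = 2π·T³/3`. [folklore] -/
theorem integral_integral_sq_radius (T : ℝ) :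
    ∫ t in (0 : ℝ)..T, ∫ _θ in (0 : ℝ)..2 * π, t ^ 2 = 2 * Real.pi * T ^ 3 / 3 := by
  simp only [intervalIntegral.integral_const, sub_zero, smul_eq_mul]
  have h : ∫ t in (0 : ℝ)..T, 2 * π * t ^ 2 = 2 * π * ∫ t in (0 : ℝ)..T, t ^ 2 := intervalIntegral.integral_const_mul _ _
  rw [h, integral_pow]
  ring

end Summit.NavierStokesRegularity.NavierStokesRegularity.Theorems.PowerGaugeEulerLiouville.HoopCore

end
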